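import Summits.ABC.IUTFork.Repair.ObstructionSS28Window
import HarnessLib

/-!
# IUT REPAIR branch → R-H (D-0079), abc-iut-rp-s2 lineage — `ObstructionSS28Budget`: the WORST-CASE budget door
# (off-window cells priced at their full floor) — companion of the slack ledger `ObstructionSS28Window` (p451819)

PROOF-ONLY satellite (own namespace `Summit.ABC.IUTFork.Repair.ObstructionSS28Budget`; D-0012: 0 definitions, 0 `Prop` facts; abc-iut cell,
rung LADDER-ABC:A2.RP → A2.RESCUE-H; seat abc-iut-rp-s2 gen 4, R-H k2 hand #2). TAKES NO SIDE on [IUTchIII] Cor. 3.12 or on any author;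
RP-I05 `HInd3Hull` / RP-I06⋆ cells are abc-iut-rp-d2's CANDIDATE READINGS (bound hypotheses); typed ≠ proved; DEFS-FREEZE respected; inputs ⊆
the frozen FACT-LIST; standard axioms.

WHAT THIS FILE ADDS (for the k2 hands of plan/rescue/R-H/START-HERE.md v1 §3/§4: a PLACE- or LABEL-RESTRICTED candidate «I06⋆ on a window `W`»
rides `ObstructionSS28Window.statement_of_starOn_of_budget`, whose off-window term `−PN Σᶠ_{∉W} σ` is a HULL volume nobody may know at a
SHAPE-OPEN or NEG cell). Here the off-window cells are priced WITHOUT any knowledge of the hull there: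
* §5a `cellSlack_ge_neg_floor_at` — bridge hypotheses ∧ Thm. 3.11 (ii)(b) ∧ Θ-pin ∧ honest `j²`-scaling at the cell ⟹
  `σ_{j,v_ℚ} ≥ −(j² − 1)·(−qLocal_{j,v_ℚ})`: the hull contains the pinned Θ-image (identity indeterminacy; monotone volume), so a cell's
  DEFICIT never exceeds its FLOOR `(j² − 1)·(−qLocal)` — bed-free, no licence, no I06⋆;
* §5b `offWindow_deficit_le_floorMass` — hence `−PN Σᶠ_{∉W} σ ≤ PN Σᶠ_{∉W} (j² − 1)·(−qLocal)` (the off-window FLOOR MASS);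
* §5c **`statement_of_starOn_of_surplus_ge_floorMass`** — q-pin ∧ RP-I05 ∧ bridge hypotheses ∧ (ii)(b) ∧ Θ-pin ∧ honest scaling off `W` ∧
  I06⋆ on `W` ∧ «on-window surplus ≥ off-window floor mass» ⟹ the typed Statement. Both sides of the budget are now EXPLICIT per datum: in
  print's containers reading (`ObstructionSS28Window.cellSlack_eq_index_sub_height`) the surplus is the unit-weighted sum of the I06STAR
  table's `slack_j(w)` over the window and the floor mass is the unit-weighted sum of `(j² − 1)·ord(q)` off it — the WORST-CASE k2 route for
  seed cut (C1) (label-cut: pay the top labels' floors from the low labels' slack) and (C2) (place-cut), valid where NOTHING is known about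
  the hull off the window; `surplus_ge_floorMass_iff` records that this worst case is also what the Corollary FORCES when the off-window
  hull carries no inflation at all (`hflat`: hull volume = Θ-image volume there).
HONEST SCOPE. Pure bookkeeping over the frozen vocabulary; nothing decides a genuine cell. [claim: Mochizuki2012, status: disputed]
[cite: ScholzeStix2018, §2.2 p. 10 l. 26–30]. Axioms: standard.
-/

noncomputable section

open Set

namespace Summit.ABC.IUTFork.Repair.ObstructionSS28Budget

open Thm311 Cor312 Cor312Vol Literature.IUT.LogThetaLattice Summit.ABC.IUTFork.Repair.CandInternal2
  Summit.ABC.IUTFork.Repair.CandInternal11Gap Summit.ABC.IUTFork.Repair.CandInternal11GapWindow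
  Summit.ABC.IUTFork.Repair.ObstructionSS28Window

variable {T : ThetaIndex} (S : LatticeSituation T) (P : Cor312.Setting S.toSituation)
  (ρ : (∀ v : T.V, v ∈ T.Vbad → Set (S.L.StarPacket v)) → ∀ (j : T.Label) (vQ : T.VQ), Set (S.L.Packet j vQ))
  (qK : ∀ v : T.V, v ∈ T.Vbad → Set (S.L.StarPacket v)) (W : Set (Fin T.lstar × T.VQ))

/-! ## §5a. A cell's deficit never exceeds its floor -/

/-- **INFLATION IS NONNEGATIVE** (bridge hypotheses): the holomorphic hull contains the (Ind3)-enlarged Θ-image (identity indeterminacy, abc-iut-c312-6's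
`thetaRegion_subset_thetaHull` shape), both admissible, volume monotone. [claim: Mochizuki2012, status: disputed] -/
theorem logvol_thetaRegion3_le_logvol_thetaHull (HB : BridgeHyps P) (i : Fin T.lstar) (vQ : T.VQ) :
    (S.D P.n).logvol _ vQ (P.thetaRegion3 (Setting.labelSucc i) vQ) ≤ (S.D P.n).logvol _ vQ (P.thetaHull (Setting.labelSucc i) vQ) :=
  HB.mono i vQ (HB.image_adm i vQ _ (P.thetaRegion3_mem_possibleImages _ vQ))
    (P.thetaHull_adm (hullDefined_of_thetaFinite HB.finite i vQ))
    ((Set.subset_sUnion_of_mem (P.thetaRegion3_mem_possibleImages _ vQ)).trans ((P.frame _ vQ).subset_hull _))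

/-- **A CELL'S DEFICIT NEVER EXCEEDS ITS FLOOR.** Under the bridge hypotheses, Thm. 3.11 (ii)(b), the Θ-pin and honest `j²`-scaling at the cell
`(i+1, v_ℚ)`: `−((i+1)² − 1)·(−qLocal) ≤ σ = logvol(hull) − qLocal` — no licence, no I06⋆, nothing about the hull beyond «it contains the Θ-image».
[claim: Mochizuki2012, status: disputed] -/
theorem cellSlack_ge_neg_floor_at (HB : BridgeHyps P) (hKumB : (S.col P.n).KummerB (S.D P.n)) (hΘ : ThetaPinned S P ρ) (i : Fin T.lstar)
    (vQ : T.VQ)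
    (hscaled : (S.D P.n).logvol _ vQ (ρ (S.D P.n).Ψ (Setting.labelSucc i) vQ) =
      (((i : ℕ) + 1 : ℕ) : ℝ) ^ 2 * P.qLocal (Setting.labelSucc i) vQ) :
    -(((((i : ℕ) + 1 : ℕ) : ℝ) ^ 2 - 1) * (-P.qLocal (Setting.labelSucc i) vQ)) ≤
      (S.D P.n).logvol _ vQ (P.thetaHull (Setting.labelSucc i) vQ) - P.qLocal (Setting.labelSucc i) vQ := by
  have h := logvol_thetaRegion3_le_logvol_thetaHull S P HB i vQ
  rw [thetaRegion3_eq_of_thetaPinned S P ρ hKumB hΘ, hscaled] at h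
  linarith

/-! ## §5b. Off the window: deficit ≤ floor mass -/

/-- The floor function `v_ℚ ↦ ((i+1)² − 1)·(−qLocal_{i+1,v_ℚ})` is finitely supported (Prop. 3.9 (iii), `Setting.qSupport_finite`). [folklore] -/
theorem floor_support_finite (i : Fin T.lstar) :
    (Function.support fun vQ : T.VQ => ((((i : ℕ) + 1 : ℕ) : ℝ) ^ 2 - 1) * (-P.qLocal (Setting.labelSucc i) vQ)).Finite := by
  refine (P.qSupport_finite (Setting.labelSucc i)).subset fun vQ hvQ => ?_
  have h0 : P.qLocal (Setting.labelSucc i) vQ ≠ 0 := fun h0 =>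
    hvQ (show ((((i : ℕ) + 1 : ℕ) : ℝ) ^ 2 - 1) * (-P.qLocal (Setting.labelSucc i) vQ) = 0 by rw [h0]; ring)
  exact h0

/-- Label by label, off the window the floor sum dominates minus the slack sum: `0 ≤ Σᶠ_{∉W} floor + Σᶠ_{∉W} σ` (pointwise §5a on the
off-window cells; indicator bookkeeping, finite supports from Prop. 3.9 (iii) and `ThetaFinite`). [claim: Mochizuki2012, status: disputed] -/
theorem finsum_offWindow_floor_add_cellSlack_nonneg (HB : BridgeHyps P) (hKumB : (S.col P.n).KummerB (S.D P.n)) (hΘ : ThetaPinned S P ρ)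
    (hscaled_off : ∀ (i : Fin T.lstar) (vQ : T.VQ), (i, vQ) ∉ W →
      (S.D P.n).logvol _ vQ (ρ (S.D P.n).Ψ (Setting.labelSucc i) vQ) = (((i : ℕ) + 1 : ℕ) : ℝ) ^ 2 * P.qLocal (Setting.labelSucc i) vQ)
    (i : Fin T.lstar) :
    0 ≤ (∑ᶠ vQ ∈ {vQ : T.VQ | (i, vQ) ∉ W}, ((((i : ℕ) + 1 : ℕ) : ℝ) ^ 2 - 1) * (-P.qLocal (Setting.labelSucc i) vQ)) +
      ∑ᶠ vQ ∈ {vQ : T.VQ | (i, vQ) ∉ W},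
        ((S.D P.n).logvol _ vQ (P.thetaHull (Setting.labelSucc i) vQ) - P.qLocal (Setting.labelSucc i) vQ) := by
  have hf : (Function.support ({vQ : T.VQ | (i, vQ) ∉ W}.indicator fun vQ : T.VQ =>
      ((((i : ℕ) + 1 : ℕ) : ℝ) ^ 2 - 1) * (-P.qLocal (Setting.labelSucc i) vQ))).Finite := by
    rw [Set.support_indicator]
    exact (floor_support_finite S P i).inter_of_right _
  have hg : (Function.support ({vQ : T.VQ | (i, vQ) ∉ W}.indicator fun vQ : T.VQ =>
      (S.D P.n).logvol _ vQ (P.thetaHull (Setting.labelSucc i) vQ) - P.qLocal (Setting.labelSucc i) vQ)).Finite := by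
    rw [Set.support_indicator]
    exact (cellSlack_support_finite S P HB.finite i).inter_of_right _
  rw [finsum_mem_def, finsum_mem_def, ← finsum_add_distrib hf hg]
  refine finsum_nonneg fun vQ => ?_
  by_cases hW : (i, vQ) ∈ W
  · have hn : vQ ∉ {vQ : T.VQ | (i, vQ) ∉ W} := fun h => h hW
    simp only [Set.indicator_of_notMem hn, add_zero, le_refl]
  · have hm : vQ ∈ {vQ : T.VQ | (i, vQ) ∉ W} := hW
    simp only [Set.indicator_of_mem hm]
    have h := cellSlack_ge_neg_floor_at S P ρ HB hKumB hΘ i vQ (hscaled_off i vQ hW)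
    linarith

/-- **OFF-WINDOW DEFICIT ≤ OFF-WINDOW FLOOR MASS.** Under the bridge hypotheses, (ii)(b), the Θ-pin and honest scaling at every cell off the window
`W`: `−PN(i ↦ Σᶠ_{v_ℚ : (i,v_ℚ) ∉ W} σ) ≤ PN(i ↦ Σᶠ_{v_ℚ : (i,v_ℚ) ∉ W} ((i+1)² − 1)·(−qLocal))`. [claim: Mochizuki2012, status: disputed] -/
theorem offWindow_deficit_le_floorMass (HB : BridgeHyps P) (hKumB : (S.col P.n).KummerB (S.D P.n)) (hΘ : ThetaPinned S P ρ)
    (hscaled_off : ∀ (i : Fin T.lstar) (vQ : T.VQ), (i, vQ) ∉ W →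
      (S.D P.n).logvol _ vQ (ρ (S.D P.n).Ψ (Setting.labelSucc i) vQ) = (((i : ℕ) + 1 : ℕ) : ℝ) ^ 2 * P.qLocal (Setting.labelSucc i) vQ) :
    -processionNormalized (fun i : Fin T.lstar => ∑ᶠ vQ ∈ {vQ : T.VQ | (i, vQ) ∉ W},
          ((S.D P.n).logvol _ vQ (P.thetaHull (Setting.labelSucc i) vQ) - P.qLocal (Setting.labelSucc i) vQ)) ≤
      processionNormalized (fun i : Fin T.lstar => ∑ᶠ vQ ∈ {vQ : T.VQ | (i, vQ) ∉ W},
          ((((i : ℕ) + 1 : ℕ) : ℝ) ^ 2 - 1) * (-P.qLocal (Setting.labelSucc i) vQ)) := by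
  have hsum : 0 ≤ processionNormalized (fun i : Fin T.lstar => ∑ᶠ vQ ∈ {vQ : T.VQ | (i, vQ) ∉ W},
          ((((i : ℕ) + 1 : ℕ) : ℝ) ^ 2 - 1) * (-P.qLocal (Setting.labelSucc i) vQ)) +
      processionNormalized (fun i : Fin T.lstar => ∑ᶠ vQ ∈ {vQ : T.VQ | (i, vQ) ∉ W},
          ((S.D P.n).logvol _ vQ (P.thetaHull (Setting.labelSucc i) vQ) - P.qLocal (Setting.labelSucc i) vQ)) := by
    unfold processionNormalized
    rw [← add_div, ← Finset.sum_add_distrib]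
    exact div_nonneg (Finset.sum_nonneg fun i _ =>
      finsum_offWindow_floor_add_cellSlack_nonneg S P ρ W HB hKumB hΘ hscaled_off i) (Nat.cast_nonneg _)
  linarith

/-! ## §5c. The worst-case budget door -/

/-- **WORST-CASE BUDGET DOOR.** Under the q-pin, RP-I05 (`HInd3Hull`), the bridge hypotheses, Thm. 3.11 (ii)(b), the Θ-pin and honest `j²`-scaling
at the cells off the window: **I06⋆ on `W`** (abc-iut-rp-h3's cell hypothesis) and **«on-window surplus ≥ off-window floor mass»**
(`PN Σᶠ_{∉W} ((i+1)² − 1)·(−qLocal) ≤ PN Σᶠ_{W} σ`) give the typed Statement — NOTHING about the hull off `W` is used.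
[claim: Mochizuki2012, status: disputed] -/
theorem statement_of_starOn_of_surplus_ge_floorMass (HB : BridgeHyps P) (hq : QPinned S P ρ qK) (hA : HInd3Hull S P ρ)
    (hKumB : (S.col P.n).KummerB (S.D P.n)) (hΘ : ThetaPinned S P ρ)
    (hscaled_off : ∀ (i : Fin T.lstar) (vQ : T.VQ), (i, vQ) ∉ W →
      (S.D P.n).logvol _ vQ (ρ (S.D P.n).Ψ (Setting.labelSucc i) vQ) = (((i : ℕ) + 1 : ℕ) : ℝ) ^ 2 * P.qLocal (Setting.labelSucc i) vQ)
    (hon : ∀ (i : Fin T.lstar) (vQ : T.VQ), (i, vQ) ∈ W →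
      ρ qK (Setting.labelSucc i) vQ ⊆ ⋃ m : ℤ, ρ (shellSat S P.n ((S.col P.n).frobΨ m)) (Setting.labelSucc i) vQ)
    (hbudget : processionNormalized (fun i : Fin T.lstar => ∑ᶠ vQ ∈ {vQ : T.VQ | (i, vQ) ∉ W},
          ((((i : ℕ) + 1 : ℕ) : ℝ) ^ 2 - 1) * (-P.qLocal (Setting.labelSucc i) vQ)) ≤
      processionNormalized (fun i : Fin T.lstar => ∑ᶠ vQ ∈ {vQ : T.VQ | (i, vQ) ∈ W},
          ((S.D P.n).logvol _ vQ (P.thetaHull (Setting.labelSucc i) vQ) - P.qLocal (Setting.labelSucc i) vQ))) :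
    P.Statement :=
  statement_of_starOn_of_budget S P ρ qK W HB hq hA hon
    ((offWindow_deficit_le_floorMass S P ρ W HB hKumB hΘ hscaled_off).trans hbudget)

/-- The same door with the on-window cells given as VOLUME-licensed cells (`0 ≤ σ` on `W`, e.g. from any set-level licence cell via
`ObstructionSS28Window.cellSlack_nonneg_of_licenceAt`) instead of I06⋆ cells — for candidates whose window cells are licensed by another route.
[claim: Mochizuki2012, status: disputed] -/
theorem statement_of_cells_of_surplus_ge_floorMass (HB : BridgeHyps P) (hKumB : (S.col P.n).KummerB (S.D P.n)) (hΘ : ThetaPinned S P ρ)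
    (hscaled_off : ∀ (i : Fin T.lstar) (vQ : T.VQ), (i, vQ) ∉ W →
      (S.D P.n).logvol _ vQ (ρ (S.D P.n).Ψ (Setting.labelSucc i) vQ) = (((i : ℕ) + 1 : ℕ) : ℝ) ^ 2 * P.qLocal (Setting.labelSucc i) vQ)
    (hon : ∀ (i : Fin T.lstar) (vQ : T.VQ), (i, vQ) ∈ W →
      0 ≤ (S.D P.n).logvol _ vQ (P.thetaHull (Setting.labelSucc i) vQ) - P.qLocal (Setting.labelSucc i) vQ)
    (hbudget : processionNormalized (fun i : Fin T.lstar => ∑ᶠ vQ ∈ {vQ : T.VQ | (i, vQ) ∉ W},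
          ((((i : ℕ) + 1 : ℕ) : ℝ) ^ 2 - 1) * (-P.qLocal (Setting.labelSucc i) vQ)) ≤
      processionNormalized (fun i : Fin T.lstar => ∑ᶠ vQ ∈ {vQ : T.VQ | (i, vQ) ∈ W},
          ((S.D P.n).logvol _ vQ (P.thetaHull (Setting.labelSucc i) vQ) - P.qLocal (Setting.labelSucc i) vQ))) :
    P.Statement := by
  rw [statement_iff_window_budget S P W HB.finite]
  have h1 := onWindow_nonneg_of_cells S P W hon
  have h2 := offWindow_deficit_le_floorMass S P ρ W HB hKumB hΘ hscaled_off
  linarith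

/-- **When the off-window hull carries NO inflation** (inline `hflat`: hull volume = Θ-image volume at every cell off `W` — e.g. a rigid
(Ind1)/(Ind2)-orbit inside a flat frame there), the off-window deficit IS the floor mass, so under I06⋆ on `W` the Corollary holds
**iff** «surplus ≥ floor mass»: the worst case of §5c is then exact. [claim: Mochizuki2012, status: disputed] -/
theorem surplus_ge_floorMass_iff (HB : BridgeHyps P) (hq : QPinned S P ρ qK) (hA : HInd3Hull S P ρ)
    (hKumB : (S.col P.n).KummerB (S.D P.n)) (hΘ : ThetaPinned S P ρ)
    (hscaled_off : ∀ (i : Fin T.lstar) (vQ : T.VQ), (i, vQ) ∉ W →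
      (S.D P.n).logvol _ vQ (ρ (S.D P.n).Ψ (Setting.labelSucc i) vQ) = (((i : ℕ) + 1 : ℕ) : ℝ) ^ 2 * P.qLocal (Setting.labelSucc i) vQ)
    (hflat : ∀ (i : Fin T.lstar) (vQ : T.VQ), (i, vQ) ∉ W →
      (S.D P.n).logvol _ vQ (P.thetaHull (Setting.labelSucc i) vQ) = (S.D P.n).logvol _ vQ (P.thetaRegion3 (Setting.labelSucc i) vQ))
    (hon : ∀ (i : Fin T.lstar) (vQ : T.VQ), (i, vQ) ∈ W →
      ρ qK (Setting.labelSucc i) vQ ⊆ ⋃ m : ℤ, ρ (shellSat S P.n ((S.col P.n).frobΨ m)) (Setting.labelSucc i) vQ) :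
    P.Statement ↔
      processionNormalized (fun i : Fin T.lstar => ∑ᶠ vQ ∈ {vQ : T.VQ | (i, vQ) ∉ W},
            ((((i : ℕ) + 1 : ℕ) : ℝ) ^ 2 - 1) * (-P.qLocal (Setting.labelSucc i) vQ)) ≤
        processionNormalized (fun i : Fin T.lstar => ∑ᶠ vQ ∈ {vQ : T.VQ | (i, vQ) ∈ W},
            ((S.D P.n).logvol _ vQ (P.thetaHull (Setting.labelSucc i) vQ) - P.qLocal (Setting.labelSucc i) vQ)) := by
  -- off the window the cell slack IS minus the floor
  have hcell : ∀ (i : Fin T.lstar) (vQ : T.VQ), (i, vQ) ∉ W →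
      (S.D P.n).logvol _ vQ (P.thetaHull (Setting.labelSucc i) vQ) - P.qLocal (Setting.labelSucc i) vQ =
        -(((((i : ℕ) + 1 : ℕ) : ℝ) ^ 2 - 1) * (-P.qLocal (Setting.labelSucc i) vQ)) := fun i vQ hW => by
    rw [hflat i vQ hW, thetaRegion3_eq_of_thetaPinned S P ρ hKumB hΘ, hscaled_off i vQ hW]
    ring
  -- label by label, the off-window slack sum is minus the off-window floor sum (indicator bookkeeping; no finiteness of the window needed)
  have hlab : ∀ i : Fin T.lstar,
      ∑ᶠ vQ ∈ {vQ : T.VQ | (i, vQ) ∉ W},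
          ((S.D P.n).logvol _ vQ (P.thetaHull (Setting.labelSucc i) vQ) - P.qLocal (Setting.labelSucc i) vQ) =
        -∑ᶠ vQ ∈ {vQ : T.VQ | (i, vQ) ∉ W}, ((((i : ℕ) + 1 : ℕ) : ℝ) ^ 2 - 1) * (-P.qLocal (Setting.labelSucc i) vQ) := fun i => by
    rw [finsum_mem_def, finsum_mem_def, ← finsum_neg_distrib]
    refine finsum_congr fun vQ => ?_
    by_cases hW : (i, vQ) ∈ W
    · have hn : vQ ∉ {vQ : T.VQ | (i, vQ) ∉ W} := fun h => h hW
      simp only [Set.indicator_of_notMem hn, neg_zero]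
    · have hm : vQ ∈ {vQ : T.VQ | (i, vQ) ∉ W} := hW
      simp only [Set.indicator_of_mem hm, hcell i vQ hW]
  have hoff : processionNormalized (fun i : Fin T.lstar => ∑ᶠ vQ ∈ {vQ : T.VQ | (i, vQ) ∉ W},
        ((S.D P.n).logvol _ vQ (P.thetaHull (Setting.labelSucc i) vQ) - P.qLocal (Setting.labelSucc i) vQ)) =
      -processionNormalized (fun i : Fin T.lstar => ∑ᶠ vQ ∈ {vQ : T.VQ | (i, vQ) ∉ W},
        ((((i : ℕ) + 1 : ℕ) : ℝ) ^ 2 - 1) * (-P.qLocal (Setting.labelSucc i) vQ)) := by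
    unfold processionNormalized
    rw [← neg_div, ← Finset.sum_neg_distrib]
    exact congrArg (fun x => x / (T.lstar : ℝ)) (Finset.sum_congr rfl fun i _ => hlab i)
  rw [statement_iff_budget_of_starOn S P ρ qK W HB hq hA hon, hoff, neg_neg]

end Summit.ABC.IUTFork.Repair.ObstructionSS28Budget

end
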